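import Mathlib
import Summits.NavierStokesRegularity.FluidComputer.BorderedEigenpairConjugation
import Summits.NavierStokesRegularity.FluidComputer.BorderedEigenpairMasterNested

/-!
# THEOREM 3-B-NESTED from matrix data: the certified eigenvalue is REAL ((N7)) when the float
eigenvalue is real and the matrix data are conjugation-symmetric (profile-cert-3 g5, cell `ns-blowup`,
2026-08-26)

HONEST FRAMING (human rulings D-0035/D-0074): nothing here is a claim about Navier–Stokes blow-up.
WHAT THIS IS NOT: not NS evidence. MODEL lane bookkeeping about the FORMAT of the F5 eigenpair
certificates of GROUP B (class-II rows of `CertificateAbcSpectrum*` print «λ⋆ real»). Composition of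
`BorderedEigenpairMasterNested.im_eq_zero_of_certified` (p456956) with
`BorderedEigenpairConjugation.hconj_of_symmetric_data` (p466958): the CLAUSES delivered by
`BorderedEigenpairFromSections.certified_eigenpair_of_sections_nested` (p465285) — eigen-equation
`R_λ⋆ w⋆ = 0`, the ball `‖S₀ w⋆ − ṽ‖² + |λ⋆ − λ̃|² ≤ ρ²`, the normalisation `⟪ṽ_h, S₀ w⋆⟫ = ⟪ṽ_h, ṽ⟫`,
the isolation «`R_z` invertible on `0 < |z − λ⋆| < r_iso`» — plus `λ̃ ∈ ℝ`, `2ρ < r_iso`,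
`⟪ṽ_h, ṽ⟫ ≠ 0`, and conjugation-symmetric MATRIX data (index involution `σ`, `conj d_{σ i} = d_i`,
`t_{σ i, σ j} = conj t_ij` for the operator acting in coordinates by `t`) give `Im λ⋆ = 0`.

Mathlib + the two files named; no new definitions. bears_on LADDER-NS N5 / Z4-a(1)(2); evidence-only
for `EpisodeBase` (stmt-NavierStokesRegularity-19179). [folklore].
-/

noncomputable section

namespace Summit.NavierStokesRegularity.FluidComputer.BorderedEigenpairFromSectionsReal

open scoped InnerProductSpace ComplexConjugate

variable {H : Type*} [NormedAddCommGroup H] [InnerProductSpace ℂ H] [CompleteSpace H]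
variable {ι : Type*} (b : HilbertBasis ι ℂ H)

/-- **(N7) from matrix data.** See the module docstring. `R_z = 1 − T − (x₀ − z) diag(d)`, `x₀ ∈ ℝ`. -/
theorem im_eq_zero_of_certified_clauses (σ : ι → ι) (hσ : Function.Involutive σ)
    (d : lp (fun _ : ι => ℂ) ⊤) (hd : ∀ i, conj (d (σ i)) = d i) (T : H →L[ℂ] H) (t : ι → ι → ℂ)
    (hcoord : ∀ x i, b.repr (T x) i = ∑' j, t i j * b.repr x j)
    (ht : ∀ i j, t (σ i) (σ j) = conj (t i j)) (x₀ lt : ℝ) (lam : ℂ) (ws vc vr : H)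
    {ρ riso : ℝ} (hρ : 0 ≤ ρ)
    (hws : ((1 : H →L[ℂ] H) - T - ((x₀ : ℂ) - lam) • b.diagonalCLM d) ws = 0)
    (hball : ‖b.diagonalCLM d ws - vc‖ ^ 2 + ‖lam - (lt : ℂ)‖ ^ 2 ≤ ρ ^ 2)
    (hnorm : ⟪vr, b.diagonalCLM d ws⟫_ℂ = ⟪vr, vc⟫_ℂ) (hvc : ⟪vr, vc⟫_ℂ ≠ 0) (h2ρ : 2 * ρ < riso)
    (hiso : ∀ z : ℂ, z ≠ lam → ‖z - lam‖ < riso →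
      IsUnit ((1 : H →L[ℂ] H) - T - ((x₀ : ℂ) - z) • b.diagonalCLM d)) :
    lam.im = 0 := by
  have hws0 : b.diagonalCLM d ws ≠ 0 := fun h => by
    rw [h, inner_zero_right] at hnorm
    exact hvc hnorm.symm
  have hclose : ‖lam - (lt : ℂ)‖ ≤ ρ := by
    have h2 : ‖lam - (lt : ℂ)‖ ^ 2 ≤ ρ ^ 2 :=
      le_trans (by nlinarith [sq_nonneg ‖b.diagonalCLM d ws - vc‖]) hball
    exact (pow_le_pow_iff_left₀ (norm_nonneg _) hρ two_ne_zero).mp h2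
  exact BorderedEigenpairMasterNested.im_eq_zero_of_certified (b.diagonalCLM d) T (x₀ : ℂ) lt lam ws
    hws hws0 hclose h2ρ hiso
    (fun z hz =>
      BorderedEigenpairConjugation.hconj_of_symmetric_data b σ hσ d hd T t hcoord ht x₀ z hz)

end Summit.NavierStokesRegularity.FluidComputer.BorderedEigenpairFromSectionsReal

end
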